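import Mathlib
import Literature.NumberTheory.Sieve.Maynard2016Lemma8Reduction
import Literature.NumberTheory.Sieve.MaynardTaoLargeKProofs
import HarnessLib

/-!
# Maynard 2016, Lemma 8, `F`-part: reduced to ONE approximation fact over the PROVED Maynard-2015 bound

Topic `Literature/NumberTheory/Sieve`. J. Maynard, *Large gaps between primes*, Ann. of Math. (2)
183 (2016), 915–933 = arXiv:1408.5110, §8, proof of Lemma 8 (p. 13):

> "By [Maynard 2015], we have that `J_k^{(1)}(F_k)/I_k^{(1)}(F_k) ≫ (log k)/k`. We choose `F_{ℓ,j}`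
> such that `F` is a smooth approximation to `F_k(10t_1, …, 10t_k)` supported on
> `{t ∈ [0,∞)^k : Σ_i t_i ≤ 1/10}` with `J_k^{(1)}(F)/I_k^{(1)}(F) ≥ (1/10 − ε) J_k^{(1)}(F_k)/I_k^{(1)}(F_k)`,
> which gives the result. We can choose such an approximation `F` since the set of symmetric,
> non-negative linear combinations of direct products of smooth compactly supported functions on
> `[0,1]^k` is `L²` and `L¹` dense in the set of non-negative symmetric `L²`-integrable functions
> on `[0,1]^k`."

The first sentence is the tree's PROVED `exists_maynardFunctional_gt_holds`
(`MaynardTaoLargeKProofs`: for `k ≥ 2^35` an admissible `F` on the unit simplex `R_k` with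
`(Σ_m J_k^{(m)}(F))/I_k(F) > log k − 2 log log k − 2`); we re-export it with the (evident, but not
exported) non-negativity of the witness `F = 1_{R_k} ∏ g(k t_i)` (`exists_nonneg_maynardFunctional_gt`,
same proof). The second and third sentences are typed as ONE named fact,

* `Lemma8Density` — for every non-negative admissible `F` on `R_k` and every `ε > 0` there are smooth
  data `(J, c_j, F_{ℓ,j})` of the class (5.3)–(5.5) with
  `|I^{(1)} − 10^{−k} I_k(F)| ≤ ε` and `|J^{(1),i} − 10^{−k−1} J_k^{(i)}(F)| ≤ ε` for all `i`
  (the functionals of `t ↦ F(10t)` are exactly `10^{−k} I_k(F)`, `10^{−k−1} J_k^{(i)}(F)`; so this is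
  "`F` is a smooth approximation to `F_k(10t)`" together with the `L²`-continuity of the
  functionals) — not proved here;

and the `F`-part `Lemma8F` (`Maynard2016Lemma8Reduction`) is PROVED from it:
`lemma8F_of_density : Lemma8Density → Lemma8F` (for `log k ≥ 64`,
`log k − 2 log log k − 2 ≥ (log k)/2`, so `Σ_i 10^{−k−1} J_k^{(i)} ≥ ((log k)/20) · 10^{−k} I_k`; with
`ε = min(I/2, (log k) I/(40 k))`, `I = 10^{−k} I_k(F)`, the data have
`Σ_i J^{(1),i} ≥ ((log k)/80) I^{(1)} > 0`). Hence Maynard's Theorem 1 from the two named facts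
`Lemma7` and `Lemma8Density`: `theorem1_of_lemma7_density`.

## References

* J. Maynard, *Large gaps between primes*, Ann. of Math. (2) 183 (2016), 915–933; arXiv:1408.5110,
  Lemma 8 and its proof (p. 13). [Maynard2016LargeGaps]
* J. Maynard, *Small gaps between primes*, Ann. of Math. (2) 181 (2015), 383–413, Prop. 4.3 (3) and
  §7 (arXiv §8) (the function `F_k`). [Maynard2015]
-/

open Filter Finset MeasureTheory Set
open scoped Topology ContDiff

namespace Literature.NumberTheory.Sieve

namespace Maynard2016

open MaynardLargeK

/-! ### Maynard 2015, Prop. 4.3 (3) with a non-negative witness -/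

/-- **Maynard 2015, Prop. 4.3 (3), non-negative witness**: for `k ≥ 2^35` there is a NON-NEGATIVE
admissible `F` on `R_k` with `(Σ_m J_k^{(m)}(F))/I_k(F) > log k − 2 log log k − 2`. Identical to
the tree's `exists_maynardFunctional_gt_holds` (whose witness `F = 1_{R_k} ∏_i g(t_i)`,
`g = 1_{[0,τ]} (1 + B u)⁻¹ ≥ 0`, is non-negative); the non-negativity is recorded because the
approximation step of Maynard 2016 is stated for non-negative functions. [cite: Maynard2015, Prop. 4.3 (3), §7] -/
theorem exists_nonneg_maynardFunctional_gt :
    ∃ k₀ : ℕ, ∀ k ≥ k₀, ∃ F : (Fin k → ℝ) → ℝ, IsMaynardAdmissible k F ∧ (∀ t, 0 ≤ F t) ∧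
      Real.log k - 2 * Real.log (Real.log k) - 2 < maynardFunctional k F := by
  refine ⟨2 ^ 35, fun k hk => ?_⟩
  obtain ⟨n, rfl⟩ : ∃ n, k = n + 1 := ⟨k - 1, by omega⟩
  obtain ⟨kR, hkR⟩ : ∃ kR : ℝ, kR = (n : ℝ) + 1 := ⟨_, rfl⟩
  have hk35 : (2 : ℝ) ^ 35 ≤ kR := by rw [hkR]; exact_mod_cast hk
  have hkpos : 0 < kR := by rw [hkR]; positivity
  obtain ⟨ℓ, hℓ⟩ : ∃ ℓ : ℝ, ℓ = Real.log kR := ⟨_, rfl⟩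
  have hℓ24 : 24 ≤ ℓ := by
    have h1 : Real.log ((2 : ℝ) ^ 35) ≤ ℓ := by rw [hℓ]; exact Real.log_le_log (by positivity) hk35
    rw [Real.log_pow] at h1
    have h2 := Real.log_two_gt_d9
    push_cast at h1
    linarith
  have hℓpos : 0 < ℓ := by linarith
  obtain ⟨A, hA⟩ : ∃ A : ℝ, A = ℓ - 2 * Real.log ℓ := ⟨_, rfl⟩
  have hA16 : 16 ≤ A := hA ▸ sixteen_le_sub_two_mul_log hℓ24
  have hApos : 0 < A := by linarith
  obtain ⟨e, he⟩ : ∃ e : ℝ, e = Real.exp A := ⟨_, rfl⟩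
  have hepos : 0 < e := by rw [he]; exact Real.exp_pos A
  have hke : kR = e * ℓ ^ 2 := by
    have h1 : Real.exp ℓ = kR := by rw [hℓ, Real.exp_log hkpos]
    have h2 : Real.exp (2 * Real.log ℓ) = ℓ ^ 2 := by
      rw [two_mul, Real.exp_add, Real.exp_log hℓpos, sq]
    rw [he, hA, Real.exp_sub, h1, h2]
    field_simp
  obtain ⟨B, hB⟩ : ∃ B : ℝ, B = A * kR := ⟨_, rfl⟩
  have hBpos : 0 < B := by rw [hB]; positivity
  obtain ⟨τ, hτ⟩ : ∃ τ : ℝ, τ = (e - 1) / (A * kR) := ⟨_, rfl⟩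
  have hτ0 : 0 ≤ τ := by
    rw [hτ]
    have he1 : 1 ≤ e := by rw [he]; linarith [Real.add_one_le_exp A]
    exact div_nonneg (by linarith) (by positivity)
  have hBτ : 1 + B * τ = e := by
    rw [hB, hτ]; field_simp; ring
  obtain ⟨g, hg⟩ : ∃ g : ℝ → ℝ, g = fun x => (Icc 0 τ).indicator (fun x => (1 + B * x)⁻¹) x :=
    ⟨_, rfl⟩
  have hgm : Measurable g := by rw [hg]; exact measurable_indicator_inv
  have hg0 : ∀ x, 0 ≤ g x := fun x => by rw [hg]; exact indicator_inv_nonneg hBpos.le x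
  have hg1 : ∀ x, g x ≤ 1 := fun x => by rw [hg]; exact indicator_inv_le_one hBpos.le x
  have hgsupp : ∀ x, g x ≠ 0 → x ∈ Icc 0 τ := fun x hx =>
    Set.mem_of_indicator_ne_zero (by rwa [hg] at hx)
  have hg₀ : 0 < (1 + B * τ)⁻¹ := by rw [hBτ]; positivity
  have hgmin : ∀ x ∈ Icc 0 τ, (1 + B * τ)⁻¹ ≤ g x := fun x hx => by
    rw [hg]; exact inv_le_indicator_inv hBpos.le hx
  have hL : ∫ x, g x = A / (A * kR) := by
    have : ∫ x, g x = Real.log (1 + B * τ) / B := by rw [hg]; exact integral_indicator_inv hBpos hτ0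
    rw [this, hBτ, he, Real.log_exp, hB]
  have hW : ∫ x, g x ^ 2 = (1 - e⁻¹) / (A * kR) := by
    have : ∫ x, g x ^ 2 = (1 - (1 + B * τ)⁻¹) / B := by
      rw [hg]; exact integral_indicator_inv_sq hBpos hτ0
    rw [this, hBτ, hB]
  have hM1 : ∫ x, x * g x ^ 2 = (A - 1 + e⁻¹) / (A * kR) ^ 2 := by
    have : ∫ x, x * g x ^ 2 = (Real.log (1 + B * τ) - 1 + (1 + B * τ)⁻¹) / B ^ 2 := by
      rw [hg]; exact integral_mul_indicator_inv_sq hBpos hτ0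
    rw [this, hBτ, he, Real.log_exp, hB, ← he]
  set ν := (∫ x, x * g x ^ 2) / ∫ x, g x ^ 2 with hν
  have hν' : ν = ((A - 1 + e⁻¹) / (A * kR) ^ 2) / ((1 - e⁻¹) / (A * kR)) := by
    rw [hν, hW, hM1]
  obtain ⟨hτpos, hτ1, hD, hX, hfinal⟩ :=
    largeK_numeric_bound hℓ24 hA he hke hkR hτ hν'
  have hratio := le_maynardFunctional_indicator_prod (n := n) hgm hg0 hg1 hgsupp hg₀ hgmin hτpos
    hτ1 rfl rfl hD hX
  rw [← hν, hL, hW] at hratio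
  refine ⟨(maynardSimplex (n + 1)).indicator fun t => ∏ i, g (t i),
    isMaynardAdmissible_indicator_prod hgm hg0 hg1 hg₀ hgmin hτpos hτ1 rfl rfl,
    fun t => Set.indicator_nonneg (fun s _ => Finset.prod_nonneg fun i _ => hg0 (s i)) t, ?_⟩
  have hcast : (((n + 1 : ℕ) : ℝ)) = kR := by rw [hkR]; push_cast; ring
  rw [hcast, ← hℓ]
  exact lt_of_lt_of_le hfinal hratio

/-! ### The approximation step as a named fact -/

/-- **Maynard 2016, Lemma 8, approximation step** ("`F` is a smooth approximation to
`F_k(10t_1,…,10t_k)` supported on `Σ t_i ≤ 1/10` with `J^{(1)}(F)/I^{(1)}(F) ≥ (1/10 − ε) J/I`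
[...] since the set of non-negative linear combinations of direct products of smooth compactly
supported functions is `L²` dense"): for every non-negative admissible `F` on the unit simplex
`R_k` and every `ε > 0` there are smooth data `(J, c_j, F_{ℓ,j})` of the class (5.3)–(5.5) whose
functionals are within `ε` of those of `t ↦ F(10t)`, namely `10^{−k} I_k(F)` and
`10^{−k−1} J_k^{(i)}(F)`. Named fact, not proved here (the `L²`-density statement quoted, the
substitution `t ↦ 10t`, and the `L²`-continuity of `I^{(1)}`, `J^{(1),i}` on functions supported in
`Σ t_i ≤ 1/10`). [cite: Maynard2016LargeGaps, Lemma 8 (proof, approximation step)] -/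
def Lemma8Density : Prop :=
  ∀ k : ℕ, 1 ≤ k → ∀ F : (Fin k → ℝ) → ℝ, IsMaynardAdmissible k F → (∀ t, 0 ≤ F t) →
    ∀ ε : ℝ, 0 < ε →
      ∃ (J : ℕ) (cj : Fin J → ℝ) (Fd : Fin k → Fin J → ℝ → ℝ),
        IsSieveDataF k J cj Fd ∧ |I1 cj Fd - maynardI k F / 10 ^ k| ≤ ε ∧
          ∀ i, |J1 cj Fd i - maynardJ k i F / 10 ^ (k + 1)| ≤ ε

/-! ### `Lemma8F` from the approximation step -/

/-- Transfer of a ratio bound through an `ε`-approximation of the functionals. [folklore] -/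
private theorem ratio_transfer {c ℓ I S k ε I₁ S₁ : ℝ} (hc : 0 < c) (hℓ : 0 < ℓ) (hI : 0 < I)
    (hSI : c * ℓ * I ≤ S) (hε1 : ε ≤ I / 2) (hε2 : k * ε ≤ c * ℓ * I / 2)
    (hI₁lo : I - ε ≤ I₁) (hI₁hi : I₁ ≤ I + ε) (hS₁ : S - k * ε ≤ S₁) :
    0 < I₁ ∧ c / 4 * ℓ * I₁ ≤ S₁ := by
  refine ⟨by linarith, ?_⟩
  have h1 : c / 4 * ℓ * I₁ ≤ c / 4 * ℓ * (3 / 2 * I) :=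
    mul_le_mul_of_nonneg_left (by linarith) (by positivity)
  nlinarith [mul_pos hc hℓ]

/-- `log k − 2 log log k − 2 ≥ (log k)/2` once `log k ≥ 64`. [folklore] -/
private theorem half_le_sub_log {ℓ : ℝ} (hℓ : 64 ≤ ℓ) : ℓ / 2 ≤ ℓ - 2 * Real.log ℓ - 2 := by
  have hℓ0 : 0 < ℓ := by linarith
  have h1 := Real.log_le_sub_one_of_pos (Real.sqrt_pos.2 hℓ0)
  have h2 : Real.log (Real.sqrt ℓ) = Real.log ℓ / 2 := Real.log_sqrt hℓ0.le
  have h3 : Real.sqrt ℓ ^ 2 = ℓ := Real.sq_sqrt hℓ0.le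
  have h4 : 8 ≤ Real.sqrt ℓ := by
    rw [show (8 : ℝ) = Real.sqrt (8 ^ 2) by rw [Real.sqrt_sq (by norm_num)]]
    exact Real.sqrt_le_sqrt (by norm_num; linarith)
  nlinarith

/-- **The `F`-part of Lemma 8 from the approximation step, PROVED** (with
`exists_nonneg_maynardFunctional_gt`). [cite: Maynard2016LargeGaps, Lemma 8 (proof)] -/
theorem lemma8F_of_density (hD : Lemma8Density) : Lemma8F := by
  obtain ⟨k₀, hk₀⟩ := exists_nonneg_maynardFunctional_gt
  refine ⟨1 / 20 / 4, by norm_num, max k₀ ⌈Real.exp 64⌉₊, fun k hk => ?_⟩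
  obtain ⟨F, hF, hF0, hgt⟩ := hk₀ k ((le_max_left _ _).trans hk)
  have hk64 : Real.exp 64 ≤ k :=
    (Nat.le_ceil _).trans (by exact_mod_cast (le_max_right _ _).trans hk)
  have hℓ : 64 ≤ Real.log k := by
    have := Real.log_le_log (Real.exp_pos _) hk64; rwa [Real.log_exp] at this
  have hk1R : (1 : ℝ) ≤ k := by linarith [Real.add_one_le_exp (64 : ℝ)]
  have hk1 : 1 ≤ k := by exact_mod_cast hk1R
  have hkpos : (0 : ℝ) < k := by linarith
  have hℓpos : 0 < Real.log k := by linarith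
  -- the model ratio: `Σ_i J_k^{(i)} ≥ (log k)/2 · I_k`
  have hIpos := hF.maynardI_pos
  have hfun : Real.log k / 2 < (∑ i, maynardJ k i F) / maynardI k F :=
    lt_of_le_of_lt (half_le_sub_log hℓ) hgt
  have hJsum : Real.log k / 2 * maynardI k F ≤ ∑ i, maynardJ k i F :=
    ((lt_div_iff₀ hIpos).1 hfun).le
  have hSI : 1 / 20 * Real.log k * (maynardI k F / 10 ^ k) ≤
      (∑ i, maynardJ k i F) / 10 ^ (k + 1) := by
    have h1 : 1 / 20 * Real.log k * (maynardI k F / 10 ^ k) =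
        (Real.log k / 2 * maynardI k F) / (10 ^ k * 10) := by ring
    rw [h1, pow_succ]
    exact div_le_div_of_nonneg_right hJsum (by positivity)
  have hI : 0 < maynardI k F / 10 ^ k := by positivity
  -- the approximation
  set ε : ℝ := min (maynardI k F / 10 ^ k / 2)
    (1 / 20 * Real.log k * (maynardI k F / 10 ^ k) / 2 / k) with hε
  have hεpos : 0 < ε := lt_min (by positivity) (by positivity)
  obtain ⟨J, cj, Fd, hdat, hI1, hJ1⟩ := hD k hk1 F hF hF0 ε hεpos
  have hε1 : ε ≤ maynardI k F / 10 ^ k / 2 := min_le_left _ _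
  have hε2 : (k : ℝ) * ε ≤ 1 / 20 * Real.log k * (maynardI k F / 10 ^ k) / 2 := by
    have h1 := mul_le_mul_of_nonneg_left (min_le_right (maynardI k F / 10 ^ k / 2)
      (1 / 20 * Real.log k * (maynardI k F / 10 ^ k) / 2 / k)) hkpos.le
    have h2 : (k : ℝ) * (1 / 20 * Real.log k * (maynardI k F / 10 ^ k) / 2 / k) =
        1 / 20 * Real.log k * (maynardI k F / 10 ^ k) / 2 := by field_simp
    rw [← hε] at h1
    linarith
  have hsum : (∑ i, maynardJ k i F) / 10 ^ (k + 1) - k * ε ≤ ∑ i, J1 cj Fd i := by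
    have h1 : ∀ i ∈ (Finset.univ : Finset (Fin k)),
        maynardJ k i F / 10 ^ (k + 1) - ε ≤ J1 cj Fd i := by
      intro i _
      have := (abs_le.1 (hJ1 i)).1
      linarith
    have h2 := Finset.sum_le_sum h1
    simp only [Finset.sum_sub_distrib, Finset.sum_const, Finset.card_univ, Fintype.card_fin,
      nsmul_eq_mul] at h2
    rw [Finset.sum_div]
    linarith
  have hI₁lo : maynardI k F / 10 ^ k - ε ≤ I1 cj Fd := by linarith [(abs_le.1 hI1).1]
  have hI₁hi : I1 cj Fd ≤ maynardI k F / 10 ^ k + ε := by linarith [(abs_le.1 hI1).2]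
  obtain ⟨hpos, hmain⟩ := ratio_transfer (by norm_num : (0 : ℝ) < 1 / 20) hℓpos hI hSI
    hε1 hε2 hI₁lo hI₁hi hsum
  exact ⟨J, cj, Fd, hdat, hpos, hmain⟩

/-- `Lemma8` from the approximation step. [cite: Maynard2016LargeGaps, Lemma 8] -/
theorem lemma8_of_density (hD : Lemma8Density) : Lemma8 :=
  lemma8_of_lemma8F (lemma8F_of_density hD)

/-- `GPYMeasures` from `Lemma7` and the approximation step. [cite: Maynard2016LargeGaps, §8 (final paragraph)] -/
theorem gpyMeasures_of_lemma7_density (h7 : Lemma7) (hD : Lemma8Density) : GPYMeasures :=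
  gpyMeasures_of_lemma7_lemma8F h7 (lemma8F_of_density hD)

/-- **Maynard's Theorem 1 from the two named facts `Lemma7` and `Lemma8Density`.**
[cite: Maynard2016LargeGaps, Theorem 1] -/
theorem theorem1_of_lemma7_density (h7 : Lemma7) (hD : Lemma8Density) :
    Literature.NumberTheory.Sieve.Maynard2016_theorem1 :=
  theorem1_of_lemma7_lemma8F h7 (lemma8F_of_density hD)

/-- **`∀ c, RankinConstant c` from `Lemma7` and `Lemma8Density`.** [cite: Maynard2016LargeGaps, Theorem 1] -/
theorem forall_rankinConstant_of_lemma7_density (h7 : Lemma7) (hD : Lemma8Density) (c : ℝ) :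
    Literature.NumberTheory.Sieve.RankinConstant c :=
  forall_rankinConstant_of_lemma7_lemma8F h7 (lemma8F_of_density hD) c

end Maynard2016

end Literature.NumberTheory.Sieve
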